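import Summits.MatrixMultiplication.OmegaCensus.SmallFormats.MatMulM22CheapFunctionals
import Summits.MatrixMultiplication.OmegaCensus.SmallFormats.MatMul22nLoadedPlaneRankOne
import Summits.MatrixMultiplication.OmegaCensus.SmallFormats.RankOnePlaneCapEqualityCol
import HarnessLib

/-!
# ω-census family (a): cheap output / input functionals of EVERY loaded rank-one plane, in census orientation (any field, `n ≥ 8`, length `≤ 3n+3`)

Cell `pub-omega` (unit `pub-omega-tensor`, gen 39), topic `Summits/MatrixMultiplication/OmegaCensus` (sub-folder
`SmallFormats`). Framing (verbatim): lottery ticket; floor = certified bounds/negative ranges. HONEST FRAMING: the TRANSPORT of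
tensor g38's cheap-functional law (`CheapFunctional.card_le_finrank_add_two`, p719966: Alekseev orientation `⟨m,2,2⟩`, type-F indices
`p_t = 0`) to an ARBITRARY rank-one ROW plane `{U : λᵀ U = 0}` and COLUMN plane `{U : U μ = 0}` of a computation `XY = ∑ f_i(X) g_i(Y) W_i`
of `⟨2,2,n⟩` (census orientation), with the output / input side made EXPLICIT. This is exactly the paper step «README §Laws» behind the `L`
variants of tensor g39's prescribed-marginal SAT instrument (kitjob-all4sat), now in the kernel; structural, any field; nothing on `ω`.

* `CheapCensus.cheapFunctionals_rowPlane` — `n ≥ 8`, `|ι| ≤ 3n + 3`, `λ ≠ 0`, `S` a set of indices with `λᵀ U_i = 0`: there is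
  `C ⊆ kⁿ` with `|S| ≤ dim C + 2` such that for every `c ∈ C` and every `t ∉ S`, `∑_i c_i (ν ᵥ* W_t)_i = 0` with `ν = (−λ₁, λ₀)` (`ν ⊥ λ`):
  the output functionals `Z ↦ νᵀ Z c` are computed by the terms of `S` alone.
* `CheapCensus.cheapFunctionals_colPlane` — same for a COLUMN plane `U_i μ = 0` (`μ ≠ 0`): there is `B ⊆ kⁿ` with `|S| ≤ dim B + 2` such
  that for every `b ∈ B` and `t ∉ S`, `g_t(ν bᵀ) = 0` (`ν = (−μ₁, μ₀)`): the rank-one inputs `Y = ν bᵀ` are read by the terms of `S` alone.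

Proof: sandwich `X ↦ Pᵀ X` with `P = [λ; ρ]` of determinant `1` (`exists_XsideTransform`: marginal `P U_i`, outputs `P'ᵀ W_i` with `P'`
the adjugate, whose second column is `ν`), transpose to Alekseev's orientation keeping the outputs (`w_t = (P'ᵀ W_t)ᵀ`), where `S` is
type F; apply p719966; read `w_t(i,1) = (ν ᵥ* W_t)_i`. The column version is the row version of the transpose-dual computation
(`exists_transposeDual'`: X-forms `U_iᵀ`, outputs = the Y-form coefficient matrices).
-/

namespace Summit.MatrixMultiplication.OmegaCensus.SmallFormats

open Finset Module Matrix
open Literature.Computability.AlgebraicComplexity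
open Summit.MatrixMultiplication.OmegaCensus.RankOnePlaneCapGeneral

namespace CheapCensus

variable {k : Type*} [Field k] {n : ℕ} {ι : Type*} [Fintype ι]

/-- The transposed computation `⟨2,2,n⟩ → ⟨n,2,2⟩` with Alekseev's `p_t` = row `0` of the X-marginal AND the outputs exposed
(`w_t = W_tᵀ`). -/
theorem exists_trComp_w (β : BilinComp (mulBilin k 2 2 n) ι) :
    ∃ β' : BilinComp (mulBilin k n 2 2) ι,
      (∀ t j, Alekseev2015.pvec β' t j = xMarginal β t 0 j) ∧ (∀ t, β'.w t = (β.w t)ᵀ) := by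
  refine ⟨{ f := fun t => (β.g t) ∘ₗ (Matrix.transposeLinearEquiv (Fin n) (Fin 2) k k).toLinearMap,
            g := fun t => (β.f t) ∘ₗ (Matrix.transposeLinearEquiv (Fin 2) (Fin 2) k k).toLinearMap,
            w := fun t => (β.w t)ᵀ,
            map_eq_sum := fun x y => ?_ }, fun t j => ?_, fun t => rfl⟩
  · have h := β.map_eq_sum yᵀ xᵀ
    rw [mulBilin_apply] at h
    rw [mulBilin_apply, ← Matrix.transpose_transpose (x * y), Matrix.transpose_mul, h, Matrix.transpose_sum]
    refine Finset.sum_congr rfl fun t _ => ?_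
    rw [Matrix.transpose_smul, mul_comm]
    rfl
  · show β.f t (Matrix.single j 0 (1 : k))ᵀ = xMarginal β t 0 j
    rw [Matrix.transpose_single, xMarginal_apply]

/-- Transport through an explicit pair with `P' P = 1` and `P 0 = λ`: cheap output functionals `Z ↦ (P' · 1)ᵀ Z c`. -/
private theorem cheap_of_pair (hn : 8 ≤ n) (β : BilinComp (mulBilin k 2 2 n) ι) (hι : Fintype.card ι ≤ 3 * n + 3)
    (lam : Fin 2 → k) (P P' : Matrix (Fin 2) (Fin 2) k) (hP'P : P' * P = 1)
    (hrow : ∀ d, P 0 d = lam d) (S : Finset ι) (hS : ∀ i ∈ S, Matrix.vecMul lam (xMarginal β i) = 0) :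
    ∃ C : Submodule k (Fin n → k), S.card ≤ finrank k C + 2 ∧
      ∀ c ∈ C, ∀ t, t ∉ S → ∑ i, c i * (Matrix.vecMul (fun j => P' j 1) (β.w t)) i = 0 := by
  classical
  have h1 : Pᵀ * P'ᵀ = 1 := by rw [← Matrix.transpose_mul, hP'P, Matrix.transpose_one]
  obtain ⟨β₁, hf, -, hw⟩ := exists_XsideTransform β Pᵀ P'ᵀ 1 1 h1 (Matrix.one_mul 1)
  -- the X-marginal of β₁ is `P U`
  have hmarg : ∀ i a b, xMarginal β₁ i a b = (P * xMarginal β i) a b := by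
    intro i a b
    rw [xMarginal_apply, hf, Matrix.mul_one, f_apply_eq_sum_xMarginal]
    have e1 : ∀ c d : Fin 2, (Pᵀ * Matrix.single a b (1 : k)) c d = if d = b then P a c else 0 := by
      intro c d
      simp [Matrix.mul_apply, Matrix.transpose_apply, Matrix.single_apply, ite_and]
      split_ifs <;> simp_all
    simp_rw [e1, ite_mul, zero_mul, Finset.sum_ite_eq', Finset.mem_univ, if_true, Matrix.mul_apply]
  obtain ⟨β₂, hp, hw₂⟩ := exists_trComp_w β₁
  have hS₂ : ∀ t ∈ S, Alekseev2015.pvec β₂ t = 0 := by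
    intro t ht
    funext j
    rw [hp, hmarg]
    have key : (P * xMarginal β t) 0 j = Matrix.vecMul lam (xMarginal β t) j := by
      simp only [Matrix.mul_apply, Matrix.vecMul, dotProduct, hrow]
    rw [key, hS t ht]
  obtain ⟨C, hC, hcard⟩ := CheapFunctional.card_le_finrank_add_two β₂ hn hι S hS₂
  refine ⟨C, hcard, fun c hc t ht => ?_⟩
  have h := hC c hc t ht
  have e : ∀ i, β₂.w t i 1 = (Matrix.vecMul (fun j => P' j 1) (β.w t)) i := by
    intro i
    rw [hw₂, Matrix.transpose_apply, hw, Matrix.mul_apply]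
    simp only [Matrix.vecMul, dotProduct, Matrix.transpose_apply, Fin.sum_univ_two]
  simp_rw [e] at h
  exact h

/-- An explicit determinant-one completion of a nonzero row `λ`, with its inverse (adjugate) whose second column is `(−λ₁, λ₀)`. -/
private theorem exists_pair (lam : Fin 2 → k) (hlam : lam ≠ 0) :
    ∃ P P' : Matrix (Fin 2) (Fin 2) k, P * P' = 1 ∧ P' * P = 1 ∧ (∀ d, P 0 d = lam d) ∧
      (∀ j, P' j 1 = ![-lam 1, lam 0] j) := by
  by_cases h0 : lam 0 = 0
  · have h1 : lam 1 ≠ 0 := by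
      intro h1; apply hlam; funext j; fin_cases j <;> simp [h0, h1]
    refine ⟨!![lam 0, lam 1; -(lam 1)⁻¹, 0], !![0, -lam 1; (lam 1)⁻¹, lam 0], ?_, ?_, fun d => by fin_cases d <;> rfl,
      fun j => by fin_cases j <;> rfl⟩
    · ext i j; fin_cases i <;> fin_cases j <;> simp [Matrix.mul_apply, Fin.sum_univ_two, h0, h1]
    · ext i j; fin_cases i <;> fin_cases j <;> simp [Matrix.mul_apply, Fin.sum_univ_two, h0, h1]
  · refine ⟨!![lam 0, lam 1; 0, (lam 0)⁻¹], !![(lam 0)⁻¹, -lam 1; 0, lam 0], ?_, ?_, fun d => by fin_cases d <;> rfl,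
      fun j => by fin_cases j <;> rfl⟩
    · ext i j; fin_cases i <;> fin_cases j <;> simp [Matrix.mul_apply, Fin.sum_univ_two, h0]
      ring
    · ext i j; fin_cases i <;> fin_cases j <;> simp [Matrix.mul_apply, Fin.sum_univ_two, h0]
      ring

/-- **Cheap output functionals of a loaded ROW plane** (`⟨2,2,n⟩`, any field, `n ≥ 8`, length `≤ 3n+3`): if `λᵀ U_i = 0` for all
`i ∈ S` (`λ ≠ 0`), there is `C ⊆ kⁿ` with `|S| ≤ dim C + 2` such that, with `ν = (−λ₁, λ₀)`, `∑_i c_i (ν ᵥ* W_t)_i = 0` for every `c ∈ C`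
and every `t ∉ S` — the output functionals `Z ↦ νᵀ Z c` see only the terms of `S`. -/
theorem cheapFunctionals_rowPlane (hn : 8 ≤ n) (β : BilinComp (mulBilin k 2 2 n) ι) (hι : Fintype.card ι ≤ 3 * n + 3)
    (lam : Fin 2 → k) (hlam : lam ≠ 0) (S : Finset ι) (hS : ∀ i ∈ S, Matrix.vecMul lam (xMarginal β i) = 0) :
    ∃ C : Submodule k (Fin n → k), S.card ≤ finrank k C + 2 ∧
      ∀ c ∈ C, ∀ t, t ∉ S → ∑ i, c i * (Matrix.vecMul ![-lam 1, lam 0] (β.w t)) i = 0 := by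
  obtain ⟨P, P', -, hP'P, hrow, hcol⟩ := exists_pair lam hlam
  obtain ⟨C, hcard, hC⟩ := cheap_of_pair hn β hι lam P P' hP'P hrow S hS
  refine ⟨C, hcard, fun c hc t ht => ?_⟩
  have h := hC c hc t ht
  have e : (fun j => P' j 1) = ![-lam 1, lam 0] := funext hcol
  rw [e] at h
  exact h

/-- **Cheap input vectors of a loaded COLUMN plane** (`⟨2,2,n⟩`, any field, `n ≥ 8`, length `≤ 3n+3`): if `U_i μ = 0` for all
`i ∈ S` (`μ ≠ 0`), there is `B ⊆ kⁿ` with `|S| ≤ dim B + 2` such that, with `ν = (−μ₁, μ₀)`, `g_t(ν bᵀ) = 0` for every `b ∈ B` and every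
`t ∉ S` — the rank-one inputs `Y = ν bᵀ` are read by the terms of `S` alone. -/
theorem cheapFunctionals_colPlane (hn : 8 ≤ n) (β : BilinComp (mulBilin k 2 2 n) ι) (hι : Fintype.card ι ≤ 3 * n + 3)
    (mu : Fin 2 → k) (hmu : mu ≠ 0) (S : Finset ι) (hS : ∀ i ∈ S, Matrix.mulVec (xMarginal β i) mu = 0) :
    ∃ B : Submodule k (Fin n → k), S.card ≤ finrank k B + 2 ∧
      ∀ b ∈ B, ∀ t, t ∉ S → β.g t (Matrix.vecMulVec ![-mu 1, mu 0] b) = 0 := by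
  classical
  obtain ⟨β', hf, -, hw⟩ := exists_transposeDual' β
  have hmarg : ∀ i, xMarginal β' i = (xMarginal β i)ᵀ := by
    intro i; ext a b
    rw [xMarginal_apply, hf, Matrix.transpose_single, Matrix.transpose_apply, xMarginal_apply]
  obtain ⟨B, hcard, hB⟩ := cheapFunctionals_rowPlane hn β' hι mu hmu S fun i hi => by
    rw [hmarg, Matrix.vecMul_transpose, hS i hi]
  refine ⟨B, hcard, fun b hb t ht => ?_⟩
  have h := hB b hb t ht
  rw [hw] at h
  -- `g_t` is linear: `g_t(ν bᵀ) = ∑_i b_i ∑_j ν_j g_t(E_{j i})`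
  have e : β.g t (Matrix.vecMulVec ![-mu 1, mu 0] b) =
      ∑ i, b i * (Matrix.vecMul ![-mu 1, mu 0] (Matrix.of fun μ' ν' => β.g t (Matrix.single μ' ν' (1 : k)))) i := by
    rw [dual_apply_eq_sum_single (β.g t) (Matrix.vecMulVec ![-mu 1, mu 0] b)]
    rw [Finset.sum_comm]
    refine Finset.sum_congr rfl fun i _ => ?_
    simp only [Matrix.vecMul, dotProduct, Matrix.of_apply, Matrix.vecMulVec_apply, Finset.mul_sum]
    refine Finset.sum_congr rfl fun j _ => ?_
    ring
  rw [e]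
  exact h

end CheapCensus

end Summit.MatrixMultiplication.OmegaCensus.SmallFormats
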